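import Summits.AnomalousDissipation.AnomalousDissipation.Theorems.SolenoidalFractalHomogenisationLagrangianStepFrameBackward
import Summits.AnomalousDissipation.AnomalousDissipation.Theorems.SolenoidalFractalHomogenisationLagrangianStepClosedWindow
import Summits.AnomalousDissipation.AnomalousDissipation.Theorems.SolenoidalFractalHomogenisationLagrangianStepFrameTestLipschitz
import Literature.Analysis.ODE.TorusFlowFrameRegularity
import HarnessLib

/-!
# K1L_D (stmt-AnomalousDissipation-27980), v2 road step (K1), discharge of `hG`: THE CLAMPED FRAME ENTRIES ARE IN THE CLOSURE CLASS —
# `FrameConj.smoothFamily_frameG_clamped` (helper, `--supports 27980 --as helper`; prover lead-k1l-onelevel-p1 g7; memo L22 §6)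

For the clamped exact-flow clock `τ ↦ jR + clamp(τ)/a` of a closed piece `[jR, t]`, `t ≤ jR + refresh (m+1)`, every entry
`(τ, y) ↦ frameG E m (jR + max 0 (min τ (a(t−jR)))/a) (jR) y c i` is a `SmoothFamily` (smooth slices, all iterated space derivatives jointly continuous):
`frameG = adj frameJac` on the closed window (`frameG_eq_adjugate_closed`), `frameJac = 1 + ∇disp` has every iterated derivative jointly continuous by
FR2 on the CLOSED clauses (`window_disp_clauses_closed` + `TorusFlow.continuousOn_stLift_iterPartialDeriv_flowJac_entry`), and the class is closed under
determinants of matrices of members (`SmoothFamily.det`, Leibniz formula) hence under adjugates (`Matrix.adjugate_apply`).  Consequence: the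
hypothesis `hG` of `continuous_uncurry_iterPartialDeriv_comp_backward` / `SmoothFamily.comp_backward` holds for the frame, so the backward reading of
every admissible distorted test has all iterated space derivatives jointly continuous (`SmoothFamily.comp_backward_frame`).
No sorry, no definition, no named fact.  NOT a proof of the converse reading lemma, of `stub_Vmod_EHTthg`, of K1L_D or AD; rung F-D1.A0.
-/

set_option linter.dupNamespace false

noncomputable section

namespace Summit.AnomalousDissipation.AnomalousDissipation.Theorems.SolenoidalFractalHomogenisation.LagrangianStep.FrameConj

open Set Function Filter MeasureTheory Topology
open scoped NNReal ENNReal InnerProductSpace ContDiff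
open Literature.Analysis Literature.Analysis.ODE Literature.Analysis.FunctionSpaces Literature.Analysis.FunctionSpaces.Torus
open Literature.Analysis.FluidPDE Literature.Analysis.FluidPDE.LatticeShear
open Literature.Analysis.FluidPDE.LatticeShear (LagrangianLatticeCarrier)

variable {k : ℕ}

/-! ## §1 More closure: constants, products, determinants, adjugates -/

/-- Constant scalar families are in the class. -/
theorem SmoothFamily.const (c : ℝ) : SmoothFamily (fun (_ : ℝ) (_ : UnitAddTorus (Fin 3)) => c) :=
  ⟨fun _ => isSmooth_const _, fun l => by
    cases l with
    | nil => exact continuous_const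
    | cons i l =>
      have hz := iterPartialDeriv_const (d := Fin 3) c (i :: l) (List.cons_ne_nil i l)
      have : (uncurry fun (_ : ℝ) (y : UnitAddTorus (Fin 3)) => iterPartialDeriv (i :: l) (fun _ : UnitAddTorus (Fin 3) => c) y) = fun _ => 0 := by
        funext p; simp only [uncurry, hz, Pi.zero_apply]
      rw [this]; exact continuous_const⟩

/-- Products of scalar families in the class are in the class. -/
theorem SmoothFamily.mul {a b : ℝ → UnitAddTorus (Fin 3) → ℝ} (ha : SmoothFamily a) (hb : SmoothFamily b) :
    SmoothFamily (fun τ y => a τ y * b τ y) :=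
  ha.smul hb

/-- Negation. -/
theorem SmoothFamily.neg {a : ℝ → UnitAddTorus (Fin 3) → ℝ} (ha : SmoothFamily a) : SmoothFamily (fun τ y => -a τ y) := by
  have h := (SmoothFamily.const (-1)).mul ha
  refine ⟨fun τ => ?_, fun l => ?_⟩
  · simpa using h.1 τ
  · have e : (fun τ y => -a τ y) = fun τ y => (-1 : ℝ) * a τ y := by funext τ y; ring
    rw [e]; exact h.2 l

/-- Finite products of scalar families in the class are in the class. -/
theorem SmoothFamily.prod {ι : Type*} (s : Finset ι) {f : ι → ℝ → UnitAddTorus (Fin 3) → ℝ} (hf : ∀ i ∈ s, SmoothFamily (f i)) :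
    SmoothFamily (fun τ y => ∏ i ∈ s, f i τ y) := by
  classical
  induction s using Finset.induction_on with
  | empty => simpa using SmoothFamily.const 1
  | insert a s ha ih =>
    have h := (hf a (Finset.mem_insert_self a s)).mul (ih fun i hi => hf i (Finset.mem_insert_of_mem hi))
    have e : (fun τ y => ∏ i ∈ insert a s, f i τ y) = fun τ y => f a τ y * ∏ i ∈ s, f i τ y := by
      funext τ y; rw [Finset.prod_insert ha]
    rw [e]; exact h

/-- **Determinants**: if every entry of a matrix family is in the class, so is its determinant (Leibniz formula). -/
theorem SmoothFamily.det {n : Type*} [Fintype n] [DecidableEq n] {M : ℝ → UnitAddTorus (Fin 3) → Matrix n n ℝ}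
    (hM : ∀ i j, SmoothFamily (fun τ y => M τ y i j)) : SmoothFamily (fun τ y => (M τ y).det) := by
  have e : (fun τ y => (M τ y).det) = fun τ y => ∑ σ : Equiv.Perm n, ((Equiv.Perm.sign σ : ℤ) : ℝ) * ∏ i, M τ y (σ i) i := by
    funext τ y
    rw [Matrix.det_apply]
    refine Finset.sum_congr rfl fun σ _ => ?_
    rw [Units.smul_def, zsmul_eq_mul]
  rw [e]
  exact SmoothFamily.sum _ fun σ _ => (SmoothFamily.const _).mul (SmoothFamily.prod _ fun i _ => hM (σ i) i)

/-- **Adjugates**: if every entry of a matrix family is in the class, so is every entry of its adjugate. -/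
theorem SmoothFamily.adjugate {n : Type*} [Fintype n] [DecidableEq n] {M : ℝ → UnitAddTorus (Fin 3) → Matrix n n ℝ}
    (hM : ∀ i j, SmoothFamily (fun τ y => M τ y i j)) (i j : n) : SmoothFamily (fun τ y => (M τ y).adjugate i j) := by
  have e : (fun τ y => (M τ y).adjugate i j) = fun τ y => ((M τ y).updateRow j (Pi.single i 1)).det := by
    funext τ y; rw [Matrix.adjugate_apply]
  rw [e]
  refine SmoothFamily.det fun i' j' => ?_
  by_cases h : i' = j
  · subst h
    have e' : (fun τ y => (M τ y).updateRow i' (Pi.single i 1) i' j') = fun _ _ => (Pi.single i (1:ℝ) : n → ℝ) j' := by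
      funext τ y; rw [Matrix.updateRow_self]
    rw [e']; exact SmoothFamily.const _
  · have e' : (fun τ y => (M τ y).updateRow j (Pi.single i 1) i' j') = fun τ y => M τ y i' j' := by
      funext τ y; rw [Matrix.updateRow_ne h]
    rw [e']; exact hM i' j'

/-! ## §2 The clamped frame entries are in the class -/

/-- **The clamped Jacobian entries are in the class** (FR2 on the closed clauses, composed with the clamped clock). -/
theorem smoothFamily_frameJac_clamped (E : LagrangianLatticeCarrier k) (hR : E.LevelRegular) (m : ℕ) (j : ℤ) {t : ℝ}
    (hjt : (j : ℝ) * E.refresh (m + 1) ≤ t) (htR : t ≤ (j : ℝ) * E.refresh (m + 1) + E.refresh (m + 1)) (a c : Fin 3) :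
    SmoothFamily (fun τ y => frameJac E m ((j : ℝ) * E.refresh (m + 1)
      + max 0 (min τ (E.a (m + 1) * (t - (j : ℝ) * E.refresh (m + 1)))) / E.a (m + 1)) ((j : ℝ) * E.refresh (m + 1)) y a c) := by
  have hTR : t - (j : ℝ) * E.refresh (m + 1) ≤ E.refresh (m + 1) := by linarith
  have hclc : Continuous fun τ : ℝ => max 0 (min τ (E.a (m + 1) * (t - (j : ℝ) * E.refresh (m + 1)))) / E.a (m + 1) :=
    (continuous_const.max (continuous_id.min continuous_const)).div_const _
  have hclI : ∀ τ : ℝ, max 0 (min τ (E.a (m + 1) * (t - (j : ℝ) * E.refresh (m + 1)))) / E.a (m + 1)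
      ∈ Icc 0 (t - (j : ℝ) * E.refresh (m + 1)) := fun τ => clamp_div_mem E m hjt τ
  obtain ⟨hDc, hDs, hDB⟩ := window_disp_clauses_closed E hR m j hTR
  have e : ∀ (s : ℝ) (y : UnitAddTorus (Fin 3)), frameJac E m ((j : ℝ) * E.refresh (m + 1) + s) ((j : ℝ) * E.refresh (m + 1)) y a c
      = (1 : Matrix (Fin 3) (Fin 3) ℝ) a c
        + Torus.partialDeriv c (fun z => E.disp m ((j : ℝ) * E.refresh (m + 1) + s) ((j : ℝ) * E.refresh (m + 1)) z a) y := fun s y => by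
    rw [FrameForm.frameJac_eq_of, Matrix.of_apply, hR.flowDeriv_single_apply]
  refine ⟨fun τ => ?_, fun l => ?_⟩
  · beta_reduce
    have e1 : (fun y => frameJac E m ((j : ℝ) * E.refresh (m + 1)
        + max 0 (min τ (E.a (m + 1) * (t - (j : ℝ) * E.refresh (m + 1)))) / E.a (m + 1)) ((j : ℝ) * E.refresh (m + 1)) y a c)
        = fun y => (E.flowDeriv m ((j : ℝ) * E.refresh (m + 1)
            + max 0 (min τ (E.a (m + 1) * (t - (j : ℝ) * E.refresh (m + 1)))) / E.a (m + 1)) ((j : ℝ) * E.refresh (m + 1)) y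
            (EuclideanSpace.single c (1:ℝ))) a :=
      funext fun y => by rw [FrameForm.frameJac_eq_of, Matrix.of_apply]
    rw [e1]
    exact hR.isSmooth_flowDeriv_entry m j _ a c
  · -- FR2 on `[0, t − jR]`, then compose with the clock
    have hFR2 := TorusFlow.continuousOn_stLift_iterPartialDeriv_flowJac_entry hDc hDs hDB a c l
    have hcomp : ContinuousOn (stLift fun τ y => iterPartialDeriv l (fun y => frameJac E m ((j : ℝ) * E.refresh (m + 1)
        + max 0 (min τ (E.a (m + 1) * (t - (j : ℝ) * E.refresh (m + 1)))) / E.a (m + 1)) ((j : ℝ) * E.refresh (m + 1)) y a c) y)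
        (univ ×ˢ univ) := by
      have e2 : (stLift fun τ y => iterPartialDeriv l (fun y => frameJac E m ((j : ℝ) * E.refresh (m + 1)
          + max 0 (min τ (E.a (m + 1) * (t - (j : ℝ) * E.refresh (m + 1)))) / E.a (m + 1)) ((j : ℝ) * E.refresh (m + 1)) y a c) y)
          = (stLift fun s y => iterPartialDeriv l
              (fun y => (1 : Matrix (Fin 3) (Fin 3) ℝ) a c
                + Torus.partialDeriv c (fun z => E.disp m ((j : ℝ) * E.refresh (m + 1) + s) ((j : ℝ) * E.refresh (m + 1)) z a) y) y)
            ∘ fun p : ℝ × EuclideanSpace ℝ (Fin 3) =>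
                (max 0 (min p.1 (E.a (m + 1) * (t - (j : ℝ) * E.refresh (m + 1)))) / E.a (m + 1), p.2) := by
        funext p
        simp only [stLift, Function.comp_apply, e]
      rw [e2]
      refine hFR2.comp ((hclc.comp continuous_fst).prodMk continuous_snd).continuousOn ?_
      intro p _
      exact mk_mem_prod (hclI p.1) (mem_univ _)
    rw [univ_prod_univ, continuousOn_univ] at hcomp
    exact continuous_uncurry_of_continuous_stLift hcomp

/-- **The clamped frame entries `frameG = adj frameJac` are in the class** — the hypothesis `hG` of `SmoothFamily.comp_backward` for the frame. -/
theorem smoothFamily_frameG_clamped (E : LagrangianLatticeCarrier k) (hR : E.LevelRegular) {m : ℕ} (hF : E.IsFlow m) (j : ℤ) {t : ℝ}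
    (hjt : (j : ℝ) * E.refresh (m + 1) ≤ t) (htR : t ≤ (j : ℝ) * E.refresh (m + 1) + E.refresh (m + 1)) (c i : Fin 3) :
    SmoothFamily (fun τ y => frameG E m ((j : ℝ) * E.refresh (m + 1)
      + max 0 (min τ (E.a (m + 1) * (t - (j : ℝ) * E.refresh (m + 1)))) / E.a (m + 1)) ((j : ℝ) * E.refresh (m + 1)) y c i) := by
  have hadj := SmoothFamily.adjugate (fun a c' => smoothFamily_frameJac_clamped E hR m j hjt htR a c') c i
  have hTR : t - (j : ℝ) * E.refresh (m + 1) ≤ E.refresh (m + 1) := by linarith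
  have e : (fun τ y => frameG E m ((j : ℝ) * E.refresh (m + 1)
      + max 0 (min τ (E.a (m + 1) * (t - (j : ℝ) * E.refresh (m + 1)))) / E.a (m + 1)) ((j : ℝ) * E.refresh (m + 1)) y c i)
      = fun τ y => (frameJac E m ((j : ℝ) * E.refresh (m + 1)
          + max 0 (min τ (E.a (m + 1) * (t - (j : ℝ) * E.refresh (m + 1)))) / E.a (m + 1)) ((j : ℝ) * E.refresh (m + 1)) y).adjugate c i := by
    funext τ y
    rw [frameG_eq_adjugate_closed E hR hF j hTR (clamp_div_mem E m hjt τ) y]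
  rw [e]; exact hadj

/-- **(K1) for the frame**: the backward reading `x ↦ Ψ τ (X m jR (jR + clamp(τ)/a) x)` of every family in the class (e.g. an admissible
distorted test) is in the class — all its iterated space derivatives are jointly continuous in `(τ, x)`. -/
theorem SmoothFamily.comp_backward_frame {F : Type*} [NormedAddCommGroup F] [NormedSpace ℝ F]
    (E : LagrangianLatticeCarrier k) (hR : E.LevelRegular) {m : ℕ} (hF : E.IsFlow m) (j : ℤ) {t : ℝ}
    (hjt : (j : ℝ) * E.refresh (m + 1) ≤ t) (htR : t ≤ (j : ℝ) * E.refresh (m + 1) + E.refresh (m + 1))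
    {Ψ : ℝ → UnitAddTorus (Fin 3) → F} (hΨ : SmoothFamily Ψ) :
    SmoothFamily (fun τ x => Ψ τ (E.X m ((j : ℝ) * E.refresh (m + 1)) ((j : ℝ) * E.refresh (m + 1)
      + max 0 (min τ (E.a (m + 1) * (t - (j : ℝ) * E.refresh (m + 1)))) / E.a (m + 1)) x)) := by
  have hclc : Continuous fun τ : ℝ => (j : ℝ) * E.refresh (m + 1)
      + max 0 (min τ (E.a (m + 1) * (t - (j : ℝ) * E.refresh (m + 1)))) / E.a (m + 1) :=
    continuous_const.add ((continuous_const.max (continuous_id.min continuous_const)).div_const _)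
  exact SmoothFamily.comp_backward E hR m ((j : ℝ) * E.refresh (m + 1)) hclc
    (fun c i => smoothFamily_frameG_clamped E hR hF j hjt htR c i) hΨ

end Summit.AnomalousDissipation.AnomalousDissipation.Theorems.SolenoidalFractalHomogenisation.LagrangianStep.FrameConj

end
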